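import Literature.NumberTheory.Sieve.BombieriVinogradovFacts

/-!
# Bombieri–Vinogradov from Vaughan's mean value theorem and the Siegel–Walfisz theorem

This file carries out, with complete proofs, the elementary half of Vaughan's proof of the
**Bombieri–Vinogradov theorem** (parity.S27, the named fact `Literature.NumberTheory.Sieve.bombieri_vinogradov` of
`Literature/NumberTheory/Sieve/ParityWave0.lean`; Bombieri, Mathematika 12 (1965), Thm 4;
A. I. Vinogradov 1965): the deduction

  `vaughan_meanValue → siegel_walfisz → bombieri_vinogradov`
  (`Literature.NumberTheory.Sieve.bombieri_vinogradov_of_vaughan_of_siegelWalfisz`)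

of the vendored statement (for every `A` there are `B, C` with
`∑_{q ≤ x^{1/2}(log x)^{-B}} max_{y ≤ x} max_{(a,q)=1} |ψ(y; q, a) − y/φ(q)| ≤ C x (log x)^{-A}`
for all large `x`) from the two analytic inputs of the classical proof, both vendored as named
facts:

* `Literature.NumberTheory.Sieve.vaughan_meanValue` (`BombieriVinogradovFacts.lean`; Vaughan, Acta Arith. 37
  (1980), Theorem 1; Davenport, *Multiplicative Number Theory*, ch. 28, (2)):
  `∑_{q ≤ Q} (q/φ(q)) ∑*_{χ mod q} max_{y ≤ Y} |ψ(y, χ)| ≪ (Y + Y^{5/6} Q + Y^{1/2} Q²) log⁴(YQ)`;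
* `Literature.NumberTheory.Sieve.siegel_walfisz` (parity.S28, `ParityWave0.lean`; Walfisz 1936).

Vaughan (loc. cit., Theorem 3) records exactly this implication ("Theorem 1 combined with the
Siegel–Walfisz theorem easily gives [Bombieri–Vinogradov]"); the deduction written out here is
the one of Davenport, ch. 28 and of Cojocaru–Murty, *An Introduction to Sieve Methods and their
Applications*, §9.2 (proof of Theorem 9.2.1, (9.30)–(9.34)), with every constant explicit.
Consequently the discharge `bombieri_vinogradov_holds` is reduced to discharging the two named
facts above (the large-sieve input `vaughan_meanValue` needs the multiplicative large sieve,
Pólya–Vinogradov and Vaughan's identity; `siegel_walfisz` needs Siegel's theorem), neither of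
which is in Mathlib.

All auxiliary quantities (`psiPrime`, `nonCoprimePart`, `primIndex`, `induce`, `psiSubSelfSup`,
`majorant`, `totientInvSum`, `primTerm`, `vaughanTerm`) and the constant packages `SWBound`,
`VaughanBound` are defined in `BombieriVinogradovFacts.lean`; this file consists of proofs only.

## The argument (`x ≥ 9`, `L = log x`, `Q = ⌊x^{1/2}/L^B⌋`, moduli `q ≤ Q`, `1 ≤ y ≤ x`)

* **Step A** (orthogonality, Cojocaru–Murty (9.30)):
  `|ψ(y; q, a) − y/φ(q)| ≤ φ(q)⁻¹ ∑_{χ mod q} |ψ'(y, χ)|` with `ψ'(y, χ) = ψ(y, χ) − [χ = χ₀] y`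
  (`abs_chebyshevPsiMod_sub_le`, from Mathlib's
  `ArithmeticFunction.vonMangoldt.residueClass_apply`).
* **Step B** (primitive characters, Cojocaru–Murty (8.28)): if `χ` is induced by `χ₁ mod d`,
  `d ∣ q`, then `|ψ'(y, χ)| ≤ |ψ'(y, χ₁)| + R(q, x)` with
  `R(q, x) = ∑_{n ≤ x, (n,q) > 1} Λ(n) ≤ ⌊log x/log 2⌋ log q` (`norm_psiPrime_changeLevel_le`,
  `nonCoprimePart_le`, via `Chebyshev.sum_PrimePow_eq_sum_sum`).
* **Step C** (reindexing and swapping sums): summing over the pairs `(d, χ₁)`, `d ∣ q`, `χ₁`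
  primitive mod `d` (at most `∑_{d ∣ q} φ(d) = q` of them) and then over `q ≤ Q`,
  `∑_{q ≤ Q} max_a |…| ≤ W(Q) ∑_{d ≤ Q} Φ(x; d) + ⌊L/log 2⌋ Q log Q · W(Q)` (`sum_iSup_le`),
  where `Φ(x; d) = φ(d)⁻¹ ∑*_{χ₁ mod d} M(x; d, χ₁)`, `M = max_{y ≤ x} |ψ(y, χ₁)|` for `d ≥ 2`
  and `1 + max_{N ≤ x} |ψ(N) − N|` for `d = 1`, and `W(Q) = ∑_{m ≤ Q} 1/φ(m) ≤ (1 + log Q)²`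
  (`totientInvSum_le`, from `m ≤ φ(m) τ(m)`; the sharper `≪ log Q` is not needed).
* **Step D** (small conductors `d ≤ D = ⌊L^B⌋`, Cojocaru–Murty (9.31), (9.33)): writing
  `ψ(y, χ₁) = ∑_{a ∈ (ℤ/d)ˣ} χ₁(a) (ψ(y; d, a) − y/φ(d))` for `χ₁ ≠ χ₀` and using Siegel–Walfisz
  for `y ≥ √x` (and the Chebyshev bound `ψ(y) ≤ 6y`, Mathlib's `Chebyshev.psi_le_const_mul_self`,
  below `√x`) gives `Φ(x; d) ≤ d (7√x + C₂ 2^{A₂} x/L^{A₂})` (`primTerm_le_of_SW`,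
  `psiSubSelfSup_le_of_SW`).
* **Step E** (large conductors `D < d ≤ Q`, Cojocaru–Murty Cor. 9.2.3 and (9.34)): Abel
  summation in inequality form (`sum_Ioc_div_le_abel`) and `vaughan_meanValue` give
  `∑_{D < d ≤ Q} Φ(x; d) ≤ C₁ log⁴(xQ) [x/(Q+1) + x^{5/6} + x^{1/2} Q + x/(D+1)
  + x^{5/6}(1 + log Q) + x^{1/2} Q]` (`sum_Ioc_primTerm_le`); with `B = A + 6`, `A₂ = 3A + 14`
  everything is `≤ C x/L^A` pointwise under explicit side conditions on `x`
  (`sum_iSup_le_of_bounds`).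
* **Step F**: the side conditions (`L ≥ 2^{A₂}`, `L^{A₂} ≤ x^{1/6}`, `L^{A+6} ≤ x^{1/2}`) hold
  eventually (`isLittleO_log_rpow_rpow_atTop`), which gives `bombieri_vinogradov` with
  `B = max(A, 1) + 6` (`bombieri_vinogradov_of_vaughan_of_siegelWalfisz`).

## References

* R. C. Vaughan, *An elementary method in prime number theory*, Acta Arith. 37 (1980), 111–115,
  Theorems 1 and 3. [Vaughan1980]
* E. Bombieri, *On the large sieve*, Mathematika 12 (1965), 201–225. [Bombieri1965]
* H. Davenport, *Multiplicative Number Theory*, 2nd ed. (Springer GTM 74, 1980), ch. 28.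
  [DavenportMNT1980]
* A. C. Cojocaru, M. R. Murty, *An Introduction to Sieve Methods and their Applications*
  (CUP, 2005), §9.2. [CojocaruMurty2005]
-/

open Finset Real
open scoped ArithmeticFunction.vonMangoldt

namespace Literature.NumberTheory.Sieve

/-! ### Step A: orthogonality -/

/-- Orthogonality of characters (Davenport, ch. 28; Cojocaru–Murty (9.30)): for `(a, q) = 1`,
`|ψ(y; q, a) − y/φ(q)| ≤ (1/φ(q)) ∑_{χ mod q} |ψ'(y, χ)|`. [folklore] -/
theorem abs_chebyshevPsiMod_sub_le (q : ℕ) [NeZero q] (a : (ZMod q)ˣ) (y : ℝ) :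
    |ParityWave0.chebyshevPsiMod q a y - y / Nat.totient q| ≤
      (Nat.totient q : ℝ)⁻¹ * ∑ χ : DirichletCharacter ℂ q, ‖psiPrime χ y‖ := by
  have ha : IsUnit ((a : ZMod q)) := a.isUnit
  have ha' : IsUnit ((a : ZMod q))⁻¹ := by
    rw [ZMod.inv_coe_unit]; exact (a⁻¹).isUnit
  have hφpos : 0 < (Nat.totient q : ℝ) := by exact_mod_cast Nat.totient_pos.mpr (NeZero.pos q)
  have h1 : ((ParityWave0.chebyshevPsiMod q a y : ℝ) : ℂ) = (Nat.totient q : ℂ)⁻¹ *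
      ∑ χ : DirichletCharacter ℂ q, χ (a : ZMod q)⁻¹ * chebyshevPsiChar χ y := by
    simp only [ParityWave0.chebyshevPsiMod, Complex.ofReal_sum,
      ArithmeticFunction.vonMangoldt.residueClass_apply ha, chebyshevPsiChar, Finset.mul_sum,
      mul_assoc]
    rw [Finset.sum_comm]
  have h3 : ∑ χ : DirichletCharacter ℂ q,
      χ (a : ZMod q)⁻¹ * (psiPrime χ y - chebyshevPsiChar χ y) = -y := by
    rw [Finset.sum_eq_single (1 : DirichletCharacter ℂ q)]
    · rw [psiPrime_one, MulChar.one_apply ha']; ring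
    · intro χ _ hχ; rw [psiPrime_of_ne_one hχ]; ring
    · simp
  have h4 : ∑ χ : DirichletCharacter ℂ q, χ (a : ZMod q)⁻¹ * psiPrime χ y =
      ∑ χ : DirichletCharacter ℂ q, χ (a : ZMod q)⁻¹ * chebyshevPsiChar χ y +
      ∑ χ : DirichletCharacter ℂ q, χ (a : ZMod q)⁻¹ * (psiPrime χ y - chebyshevPsiChar χ y) := by
    rw [← Finset.sum_add_distrib]
    exact Finset.sum_congr rfl fun χ _ => by ring
  have key : ((ParityWave0.chebyshevPsiMod q a y - y / Nat.totient q : ℝ) : ℂ) =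
      (Nat.totient q : ℂ)⁻¹ * ∑ χ : DirichletCharacter ℂ q,
        χ (a : ZMod q)⁻¹ * psiPrime χ y := by
    rw [h4, h3, mul_add, ← h1]
    push_cast
    ring
  rw [← Real.norm_eq_abs, ← Complex.norm_real, key, norm_mul, norm_inv, Complex.norm_natCast]
  refine mul_le_mul_of_nonneg_left ((norm_sum_le _ _).trans (Finset.sum_le_sum fun χ _ => ?_))
    (inv_nonneg.2 hφpos.le)
  rw [norm_mul]
  exact mul_le_of_le_one_left (norm_nonneg _) (χ.norm_le_one _)

/-- Step A for the supremum over reduced residues. [folklore] -/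
theorem iSup_abs_chebyshevPsiMod_sub_le (q : ℕ) [NeZero q] (y : ℝ) :
    ⨆ a : (ZMod q)ˣ, |ParityWave0.chebyshevPsiMod q a y - y / Nat.totient q| ≤
      (Nat.totient q : ℝ)⁻¹ * ∑ χ : DirichletCharacter ℂ q, ‖psiPrime χ y‖ :=
  ciSup_le fun a => abs_chebyshevPsiMod_sub_le q a y


/-! ### Step B: reduction to the inducing character -/

/-- If `χ mod q` is induced by `χ₁ mod d`, `d ∣ q`, then `|ψ(y, χ) − ψ(y, χ₁)| ≤ R(q, y)`: the two
sums
differ only at the `n ≤ y` with `(n, q) > 1` (Davenport, ch. 28; Cojocaru–Murty (8.28)). [folklore]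
-/
theorem norm_chebyshevPsiChar_changeLevel_sub_le {d q : ℕ} [NeZero q] (hdq : d ∣ q)
    (χ₁ : DirichletCharacter ℂ d) (y : ℝ) :
    ‖chebyshevPsiChar (DirichletCharacter.changeLevel hdq χ₁) y - chebyshevPsiChar χ₁ y‖ ≤
      nonCoprimePart q y := by
  rw [chebyshevPsiChar, chebyshevPsiChar, ← Finset.sum_sub_distrib, nonCoprimePart,
    Finset.sum_filter]
  refine (norm_sum_le _ _).trans (Finset.sum_le_sum fun n _ => ?_)
  by_cases hn : n.Coprime q
  · rw [if_neg (not_not.2 hn)]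
    have h1 : (DirichletCharacter.changeLevel hdq χ₁) (n : ZMod q) = χ₁ (n : ZMod d) := by
      have := DirichletCharacter.changeLevel_eq_cast_of_dvd' χ₁ hdq
        (a := (n : ℤ)) (Nat.isCoprime_iff_coprime.2 hn)
      simpa only [Int.cast_natCast] using this
    rw [h1, sub_self, norm_zero]
  · rw [if_pos hn, MulChar.map_nonunit _ (mt (ZMod.isUnit_iff_coprime n q).1 hn), zero_mul,
      zero_sub, norm_neg, norm_mul, Complex.norm_real,
      Real.norm_of_nonneg ArithmeticFunction.vonMangoldt_nonneg]
    exact mul_le_of_le_one_left ArithmeticFunction.vonMangoldt_nonneg (χ₁.norm_le_one _)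

/-- The same for `ψ'`: `|ψ'(y, χ)| ≤ |ψ'(y, χ₁)| + R(q, y)` when `χ` is induced by `χ₁`
(`χ` is principal iff `χ₁` is). [folklore] -/
theorem norm_psiPrime_changeLevel_le {d q : ℕ} [NeZero q] (hdq : d ∣ q)
    (χ₁ : DirichletCharacter ℂ d) (y : ℝ) :
    ‖psiPrime (DirichletCharacter.changeLevel hdq χ₁) y‖ ≤
      ‖psiPrime χ₁ y‖ + nonCoprimePart q y := by
  have h : psiPrime (DirichletCharacter.changeLevel hdq χ₁) y - psiPrime χ₁ y =
      chebyshevPsiChar (DirichletCharacter.changeLevel hdq χ₁) y - chebyshevPsiChar χ₁ y := by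
    by_cases h1 : χ₁ = 1
    · subst h1
      rw [map_one, psiPrime_one, psiPrime_one]; ring
    · rw [psiPrime_of_ne_one h1, psiPrime_of_ne_one]
      rwa [Ne, DirichletCharacter.changeLevel_eq_one_iff]
  calc ‖psiPrime (DirichletCharacter.changeLevel hdq χ₁) y‖
      = ‖psiPrime χ₁ y + (psiPrime (DirichletCharacter.changeLevel hdq χ₁) y - psiPrime χ₁ y)‖ := by
        rw [add_sub_cancel]
    _ ≤ ‖psiPrime χ₁ y‖ + ‖psiPrime (DirichletCharacter.changeLevel hdq χ₁) y - psiPrime χ₁ y‖ :=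
        norm_add_le _ _
    _ ≤ ‖psiPrime χ₁ y‖ + nonCoprimePart q y := by
        rw [h]; gcongr; exact norm_chebyshevPsiChar_changeLevel_sub_le hdq χ₁ y

/-- `∑_{n < N + 1} f(n) = ∑_{0 < n ≤ N} f(n)` when `f(0) = 0`. [folklore] -/
theorem sum_range_succ_eq_sum_Ioc' {M : Type*} [AddCommMonoid M] (f : ℕ → M) (h0 : f 0 = 0)
    (N : ℕ) : ∑ n ∈ range (N + 1), f n = ∑ n ∈ Ioc 0 N, f n := by
  rw [Finset.range_eq_Ico, Finset.sum_eq_sum_Ico_succ_bot (by omega : 0 < N + 1), h0, zero_add,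
    Finset.Ico_add_one_add_one_eq_Ioc]

/-- `∑_{p ∣ q} log p ≤ log q`. [folklore] -/
theorem sum_primeFactors_log_le {q : ℕ} (hq : q ≠ 0) :
    ∑ p ∈ q.primeFactors, Real.log p ≤ Real.log q := by
  have hP : ∀ p ∈ q.primeFactors, ((p : ℕ) : ℝ) ≠ 0 := fun p hp =>
    Nat.cast_ne_zero.2 (Nat.prime_of_mem_primeFactors hp).ne_zero
  rw [← Real.log_prod hP, ← Nat.cast_prod]
  have hpos : 0 < ∏ p ∈ q.primeFactors, p :=
    Finset.prod_pos fun p hp => (Nat.prime_of_mem_primeFactors hp).pos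
  exact Real.log_le_log (by exact_mod_cast hpos)
    (by exact_mod_cast Nat.le_of_dvd (Nat.pos_of_ne_zero hq) (Nat.prod_primeFactors_dvd q))

/-- `R(q, x) ≤ (log x / log 2) · log q`: only prime powers `p^k ≤ x` with `p ∣ q` contribute.
[folklore] -/
theorem nonCoprimePart_le {q : ℕ} (hq : q ≠ 0) {x : ℝ} (hx : 0 ≤ x) :
    nonCoprimePart q x ≤ ⌊Real.log x / Real.log 2⌋₊ * Real.log q := by
  set g : ℕ → ℝ := fun n => if n.Coprime q then 0 else Λ n with hg
  have h1 : nonCoprimePart q x = ∑ n ∈ Ioc 0 ⌊x⌋₊ with IsPrimePow n, g n := by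
    rw [nonCoprimePart, Finset.sum_filter]
    rw [show (∑ a ∈ range (⌊x⌋₊ + 1), if ¬a.Coprime q then (Λ a : ℝ) else 0) =
        ∑ n ∈ range (⌊x⌋₊ + 1), g n from
      Finset.sum_congr rfl fun n _ => by simp only [hg]; split_ifs <;> simp_all]
    rw [sum_range_succ_eq_sum_Ioc' g (by simp [hg])]
    refine (Finset.sum_filter_of_ne fun n _ hn => ?_).symm
    simp only [hg] at hn
    split_ifs at hn with h
    · exact absurd rfl hn
    · exact ArithmeticFunction.vonMangoldt_ne_zero_iff.1 hn
  rw [h1, Chebyshev.sum_PrimePow_eq_sum_sum g hx]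
  have h2 : ∀ k ∈ Icc 1 ⌊Real.log x / Real.log 2⌋₊,
      ∑ p ∈ Ioc 0 ⌊x ^ ((1 : ℝ) / k)⌋₊ with p.Prime, g (p ^ k) ≤ Real.log q := by
    intro k hk
    have hk1 : 1 ≤ k := (Finset.mem_Icc.1 hk).1
    have h3 : ∀ p ∈ (Ioc 0 ⌊x ^ ((1 : ℝ) / k)⌋₊).filter Nat.Prime,
        g (p ^ k) = if p ∣ q then Real.log p else 0 := by
      intro p hp
      have hpp : p.Prime := (Finset.mem_filter.1 hp).2
      simp only [hg]
      by_cases hpq : p ∣ q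
      · rw [if_pos hpq, if_neg, ArithmeticFunction.vonMangoldt_apply_pow (by omega),
          ArithmeticFunction.vonMangoldt_apply_prime hpp]
        intro hc
        exact hpp.ne_one ((hc.coprime_dvd_left (dvd_pow_self p (by omega))).eq_one_of_dvd hpq)
      · rw [if_neg hpq, if_pos]
        exact Nat.Coprime.pow_left k ((Nat.Prime.coprime_iff_not_dvd hpp).2 hpq)
    rw [Finset.sum_congr rfl h3, ← Finset.sum_filter]
    refine (Finset.sum_le_sum_of_subset_of_nonneg ?_ fun p hp _ =>
      Real.log_nonneg (by exact_mod_cast (Nat.prime_of_mem_primeFactors hp).one_le)).trans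
      (sum_primeFactors_log_le hq)
    intro p hp
    simp only [Finset.mem_filter] at hp
    exact Nat.mem_primeFactors.2 ⟨hp.1.2, hp.2, hq⟩
  refine (Finset.sum_le_sum h2).trans ?_
  simp


/-! ### Step C: reindexing by (conductor, primitive character) -/

section StepC
open scoped Classical

/-- `ψ(y, χ)` for the (unique) character mod `1` is `ψ(y)`. [folklore] -/
theorem chebyshevPsiChar_level_one (χ : DirichletCharacter ℂ 1) (y : ℝ) :
    chebyshevPsiChar χ y = Chebyshev.psi y := by
  rw [chebyshevPsiChar, Chebyshev.psi, sum_range_succ_eq_sum_Ioc' _ (by simp), Complex.ofReal_sum]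
  refine Finset.sum_congr rfl fun n _ => ?_
  rw [DirichletCharacter.level_one χ, MulChar.one_apply (isUnit_of_subsingleton _), one_mul]

/-- The majorant bound: for `(d, χ₁) ∈ S(q)` and `0 ≤ y ≤ x`, `‖ψ'(y, χ₁)‖ ≤ M(x; d, χ₁)`.
[folklore] -/
theorem norm_psiPrime_le_majorant {q : ℕ} {σ : Σ d : ℕ, DirichletCharacter ℂ d}
    (hσ : σ ∈ primIndex q) {y x : ℝ} (hy : 0 ≤ y) (hyx : y ≤ x) :
    ‖psiPrime σ.2 y‖ ≤ majorant x σ := by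
  obtain ⟨d, χ₁⟩ := σ
  obtain ⟨hdq, hq, hprim⟩ := mem_primIndex.1 hσ
  rw [majorant]
  split_ifs with hd
  · dsimp only at hd
    subst hd
    dsimp only
    rw [DirichletCharacter.level_one χ₁, psiPrime_one, chebyshevPsiChar_level_one,
      ← Complex.ofReal_sub, Complex.norm_real, Real.norm_eq_abs]
    exact abs_psi_sub_self_le_psiSubSelfSup hy hyx
  · dsimp only at hd ⊢
    haveI : NeZero d := ⟨fun h => hq (Nat.eq_zero_of_zero_dvd (h ▸ hdq))⟩
    have hne : χ₁ ≠ 1 := by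
      intro h
      rw [h, DirichletCharacter.isPrimitive_def, DirichletCharacter.conductor_one] at hprim
      exact hd hprim.symm
    rw [psiPrime_of_ne_one hne]
    exact norm_chebyshevPsiChar_le_sup χ₁ hyx

/-- Steps A–C combined, for one modulus `q`. [folklore] -/
theorem iSup_le_sum_primIndex (q : ℕ) [NeZero q] {y x : ℝ} (hy : 0 ≤ y) (hyx : y ≤ x) :
    ⨆ a : (ZMod q)ˣ, |ParityWave0.chebyshevPsiMod q a y - y / Nat.totient q| ≤
      (Nat.totient q : ℝ)⁻¹ * ∑ σ ∈ primIndex q, majorant x σ +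
        q / (Nat.totient q : ℝ) * nonCoprimePart q x := by
  have hφ : 0 < (Nat.totient q : ℝ) := by exact_mod_cast Nat.totient_pos.mpr (NeZero.pos q)
  refine (iSup_abs_chebyshevPsiMod_sub_le q y).trans ?_
  have h1 : ∑ χ : DirichletCharacter ℂ q, ‖psiPrime χ y‖ ≤
      ∑ σ ∈ primIndex q, ‖psiPrime (induce q σ) y‖ :=
    sum_le_sum_primIndex q fun χ => norm_nonneg _
  have h2 : ∀ σ ∈ primIndex q, ‖psiPrime (induce q σ) y‖ ≤ majorant x σ + nonCoprimePart q x := by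
    intro σ hσ
    have hdq : σ.1 ∣ q := (mem_primIndex.1 hσ).1
    rw [induce, dif_pos hdq]
    refine (norm_psiPrime_changeLevel_le hdq σ.2 y).trans ?_
    gcongr
    · exact norm_psiPrime_le_majorant hσ hy hyx
    · exact nonCoprimePart_mono q hyx
  calc (Nat.totient q : ℝ)⁻¹ * ∑ χ : DirichletCharacter ℂ q, ‖psiPrime χ y‖
      ≤ (Nat.totient q : ℝ)⁻¹ * ∑ σ ∈ primIndex q, (majorant x σ + nonCoprimePart q x) :=
        mul_le_mul_of_nonneg_left (h1.trans (Finset.sum_le_sum h2)) (inv_nonneg.2 hφ.le)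
    _ = (Nat.totient q : ℝ)⁻¹ * ∑ σ ∈ primIndex q, majorant x σ +
          (primIndex q).card / (Nat.totient q : ℝ) * nonCoprimePart q x := by
        rw [Finset.sum_add_distrib, Finset.sum_const, nsmul_eq_mul]; ring
    _ ≤ _ := by
        gcongr
        · exact nonCoprimePart_nonneg q x
        · exact_mod_cast card_primIndex_le q

end StepC


/-! ### Step C (continued): swapping the `q`- and `d`-sums; the weights `∑ 1/φ` -/

/-- Swapping the order of summation:
`∑_{q ≤ Q} g(q) ∑_{d ∣ q} F(d) = ∑_{d ≤ Q} F(d) ∑_{q ≤ Q, d ∣ q} g(q)`. [folklore] -/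
theorem sum_mul_sum_divisors_eq (Q : ℕ) (g F : ℕ → ℝ) :
    ∑ q ∈ Icc 1 Q, g q * ∑ d ∈ q.divisors, F d =
      ∑ d ∈ Icc 1 Q, F d * ∑ q ∈ Icc 1 Q with d ∣ q, g q := by
  simp_rw [Finset.mul_sum]
  rw [Finset.sum_comm' (t' := Icc 1 Q) (s' := fun d => (Icc 1 Q).filter (d ∣ ·))]
  · exact Finset.sum_congr rfl fun d _ => Finset.sum_congr rfl fun q _ => mul_comm _ _
  · intro q d
    simp only [Finset.mem_Icc, Nat.mem_divisors, Finset.mem_filter]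
    constructor
    · rintro ⟨⟨hq1, hqQ⟩, hdq, hq0⟩
      refine ⟨⟨⟨hq1, hqQ⟩, hdq⟩, Nat.pos_of_dvd_of_pos hdq hq1, (Nat.le_of_dvd hq1 hdq).trans hqQ⟩
    · rintro ⟨⟨⟨hq1, hqQ⟩, hdq⟩, hd1, hdQ⟩
      exact ⟨⟨hq1, hqQ⟩, hdq, by omega⟩

/-- `∑_{q ≤ Q, d ∣ q} g(q) ≤ ∑_{m ≤ Q} g(dm)` for `g ≥ 0` (write `q = dm`). [folklore] -/
theorem sum_filter_dvd_le (Q : ℕ) {d : ℕ} (hd : 1 ≤ d) {g : ℕ → ℝ} (hg : ∀ n, 0 ≤ g n) :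
    ∑ q ∈ Icc 1 Q with d ∣ q, g q ≤ ∑ m ∈ Icc 1 Q, g (d * m) := by
  have hsub : (Icc 1 Q).filter (d ∣ ·) ⊆ (Icc 1 Q).image (d * ·) := by
    intro q hq
    simp only [Finset.mem_filter, Finset.mem_Icc] at hq
    obtain ⟨⟨hq1, hqQ⟩, hdq⟩ := hq
    refine Finset.mem_image.2 ⟨q / d, Finset.mem_Icc.2 ⟨?_, (Nat.div_le_self q d).trans hqQ⟩,
      Nat.mul_div_cancel' hdq⟩
    exact Nat.div_pos (Nat.le_of_dvd hq1 hdq) hd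
  refine (Finset.sum_le_sum_of_subset_of_nonneg hsub fun _ _ _ => hg _).trans ?_
  rw [Finset.sum_image fun a _ b _ h => Nat.eq_of_mul_eq_mul_left hd h]

/-- `∑_{q ≤ Q, d ∣ q} 1/φ(q) ≤ W(Q)/φ(d)`, from `φ(d) φ(m) ≤ φ(dm)`. [folklore] -/
theorem sum_filter_dvd_totient_inv_le (Q : ℕ) {d : ℕ} (hd : 1 ≤ d) :
    ∑ q ∈ Icc 1 Q with d ∣ q, ((Nat.totient q : ℝ))⁻¹ ≤
      ((Nat.totient d : ℝ))⁻¹ * totientInvSum Q := by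
  refine (sum_filter_dvd_le Q hd fun n => inv_nonneg.2 (Nat.cast_nonneg _)).trans ?_
  rw [totientInvSum, Finset.mul_sum]
  refine Finset.sum_le_sum fun m hm => ?_
  have hm1 : 1 ≤ m := (Finset.mem_Icc.1 hm).1
  rw [← mul_inv]
  have h0 : 0 < (Nat.totient d : ℝ) * Nat.totient m := by
    have := Nat.totient_pos.2 hd; have := Nat.totient_pos.2 hm1; positivity
  exact inv_anti₀ h0 (by exact_mod_cast Nat.totient_super_multiplicative d m)

/-- `m ≤ φ(m) τ(m)` (multiplicativity; for a prime power `p^n ≤ p^{n-1}(p − 1)(n + 1)`). [folklore]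
-/
theorem self_le_totient_mul_card_divisors (m : ℕ) : m ≤ Nat.totient m * m.divisors.card := by
  induction m using Nat.recOnPosPrimePosCoprime with
  | prime_pow p n hp hn =>
    rw [Nat.totient_prime_pow hp hn, ← ArithmeticFunction.sigma_zero_apply,
      ArithmeticFunction.sigma_zero_apply_prime_pow hp]
    have hp2 := hp.two_le
    calc p ^ n = p ^ (n - 1) * p := by rw [← pow_succ, Nat.sub_add_cancel hn]
      _ ≤ p ^ (n - 1) * ((p - 1) * (n + 1)) := by
        refine Nat.mul_le_mul_left _ ?_
        calc p ≤ (p - 1) * 2 := by omega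
          _ ≤ (p - 1) * (n + 1) := Nat.mul_le_mul_left _ (by omega)
      _ = _ := by ring
  | zero => exact Nat.zero_le _
  | one => simp
  | coprime a b ha hb hab iha ihb =>
    rw [Nat.totient_mul hab, Nat.Coprime.card_divisors_mul hab]
    calc a * b ≤ (Nat.totient a * a.divisors.card) * (Nat.totient b * b.divisors.card) :=
        Nat.mul_le_mul iha ihb
      _ = _ := by ring

/-- `∑_{a ≤ Q} 1/a ≤ 1 + log Q` (Mathlib's `harmonic_le_one_add_log`). [folklore] -/
theorem harmonic_Icc_le (Q : ℕ) : ∑ a ∈ Icc 1 Q, ((a : ℝ))⁻¹ ≤ 1 + Real.log Q := by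
  have := harmonic_le_one_add_log Q
  rw [harmonic_eq_sum_Icc] at this
  push_cast at this
  exact this

/-- `W(Q) = ∑_{m ≤ Q} 1/φ(m) ≤ (1 + log Q)²`, a crude form of `∑_{m ≤ Q} 1/φ(m) ≪ log Q`
(from `1/φ(m) ≤ τ(m)/m` and `∑_{m ≤ Q} τ(m)/m ≤ (∑_{a ≤ Q} 1/a)²`). [folklore] -/
theorem totientInvSum_le (Q : ℕ) : totientInvSum Q ≤ (1 + Real.log Q) ^ 2 := by
  have h1 : totientInvSum Q ≤ ∑ m ∈ Icc 1 Q, ((m : ℝ))⁻¹ * ∑ a ∈ m.divisors, (1 : ℝ) := by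
    refine Finset.sum_le_sum fun m hm => ?_
    have hm1 : 1 ≤ m := (Finset.mem_Icc.1 hm).1
    rw [Finset.sum_const, nsmul_eq_mul, mul_one]
    have hφ : 0 < (Nat.totient m : ℝ) := by exact_mod_cast Nat.totient_pos.2 hm1
    have hm0 : 0 < (m : ℝ) := by exact_mod_cast hm1
    rw [inv_le_iff_one_le_mul₀ hφ, mul_assoc, inv_mul_eq_div, one_le_div hm0]
    exact_mod_cast (self_le_totient_mul_card_divisors m).trans_eq (mul_comm _ _)
  have h2 : ∑ m ∈ Icc 1 Q, ((m : ℝ))⁻¹ * ∑ a ∈ m.divisors, (1 : ℝ) ≤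
      ∑ a ∈ Icc 1 Q, ((a : ℝ))⁻¹ * ∑ b ∈ Icc 1 Q, ((b : ℝ))⁻¹ := by
    rw [sum_mul_sum_divisors_eq Q (fun m => ((m : ℝ))⁻¹) (fun _ => (1 : ℝ))]
    refine Finset.sum_le_sum fun a ha => ?_
    have ha1 : 1 ≤ a := (Finset.mem_Icc.1 ha).1
    rw [one_mul, Finset.mul_sum]
    refine (sum_filter_dvd_le Q ha1 fun n => inv_nonneg.2 (Nat.cast_nonneg n)).trans (le_of_eq ?_)
    refine Finset.sum_congr rfl fun b _ => ?_
    push_cast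
    rw [mul_inv]
  have hH := harmonic_Icc_le Q
  have hH0 : 0 ≤ ∑ a ∈ Icc 1 Q, ((a : ℝ))⁻¹ :=
    Finset.sum_nonneg fun _ _ => inv_nonneg.2 (Nat.cast_nonneg _)
  calc totientInvSum Q ≤ (∑ a ∈ Icc 1 Q, ((a : ℝ))⁻¹) * ∑ b ∈ Icc 1 Q, ((b : ℝ))⁻¹ := by
        rw [Finset.sum_mul]; exact h1.trans h2
    _ ≤ (1 + Real.log Q) * (1 + Real.log Q) := mul_le_mul hH hH hH0 (hH0.trans hH)
    _ = _ := (sq _).symm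


/-! ### Step D: from residue classes back to characters; Siegel–Walfisz bounds -/

/-- Orthogonality: `∑_{a ∈ (ℤ/d)ˣ} χ(a) = 0` for `χ ≠ χ₀`. [folklore] -/
theorem sum_units_eq_zero_of_ne_one {d : ℕ} [NeZero d] {χ : DirichletCharacter ℂ d} (hχ : χ ≠ 1) :
    ∑ a : (ZMod d)ˣ, χ (a : ZMod d) = 0 := by
  obtain ⟨b, hb⟩ := MulChar.ne_one_iff.mp hχ
  refine eq_zero_of_mul_eq_self_left hb ?_
  simp only [Finset.mul_sum, ← map_mul, ← Units.val_mul]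
  exact Fintype.sum_bijective _ (Group.mulLeft_bijective b) _ _ fun a => rfl

/-- `ψ(y, χ) = ∑_{a ∈ (ℤ/d)ˣ} χ(a) ψ(y; d, a)`. [folklore] -/
theorem chebyshevPsiChar_eq_sum_units {d : ℕ} [NeZero d] (χ : DirichletCharacter ℂ d) (y : ℝ) :
    chebyshevPsiChar χ y = ∑ a : (ZMod d)ˣ, χ (a : ZMod d) * (ParityWave0.chebyshevPsiMod d a y : ℂ) := by
  have key : ∀ n : ℕ, χ (n : ZMod d) * (Λ n : ℂ) =
      ∑ a : (ZMod d)ˣ, if (n : ZMod d) = a then χ (a : ZMod d) * (Λ n : ℂ) else 0 := by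
    intro n
    by_cases hn : IsUnit (n : ZMod d)
    · rw [Finset.sum_eq_single hn.unit]
      · simp
      · intro a _ ha
        rw [if_neg]
        intro h
        exact ha (Units.ext (by simp [h]))
      · simp
    · rw [MulChar.map_nonunit χ hn, zero_mul]
      refine (Finset.sum_eq_zero fun a _ => ?_).symm
      rw [if_neg]
      intro h
      exact hn (h ▸ a.isUnit)
  simp_rw [chebyshevPsiChar, key]
  rw [Finset.sum_comm]
  refine Finset.sum_congr rfl fun a _ => ?_
  rw [ParityWave0.chebyshevPsiMod, Complex.ofReal_sum, Finset.mul_sum]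
  refine Finset.sum_congr rfl fun n _ => ?_
  simp only [ArithmeticFunction.vonMangoldt.residueClass, Set.indicator_apply, Set.mem_setOf_eq]
  split_ifs <;> simp

/-- For `χ ≠ χ₀`: `‖ψ(y, χ)‖ ≤ ∑_{a} |ψ(y; d, a) − y/φ(d)|`. [folklore] -/
theorem norm_chebyshevPsiChar_le_sum_units {d : ℕ} [NeZero d] {χ : DirichletCharacter ℂ d}
    (hχ : χ ≠ 1) (y : ℝ) :
    ‖chebyshevPsiChar χ y‖ ≤ ∑ a : (ZMod d)ˣ, |ParityWave0.chebyshevPsiMod d a y - y / Nat.totient d| := by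
  have h : chebyshevPsiChar χ y =
      ∑ a : (ZMod d)ˣ, χ (a : ZMod d) * ((ParityWave0.chebyshevPsiMod d a y - y / Nat.totient d : ℝ) : ℂ) := by
    rw [chebyshevPsiChar_eq_sum_units]
    simp only [Complex.ofReal_sub, mul_sub, Finset.sum_sub_distrib, ← Finset.sum_mul,
      sum_units_eq_zero_of_ne_one hχ, zero_mul, sub_zero]
  rw [h]
  refine (norm_sum_le _ _).trans (Finset.sum_le_sum fun a _ => ?_)
  rw [norm_mul, Complex.norm_real, Real.norm_eq_abs]
  exact mul_le_of_le_one_left (abs_nonneg _) (χ.norm_le_one _)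

/-- Trivial + Siegel–Walfisz: for `1 ≤ q ≤ (log x / 2)^{A₂}`, `x ≥ 9`, `1 ≤ y ≤ x`:
`|ψ(y; q, a) − y/φ(q)| ≤ 7 √x + C₂ 2^{A₂} x / (log x)^{A₂}`. [folklore] -/
theorem abs_chebyshevPsiMod_sub_le_of_SW {A₂ C₂ : ℝ} (hA₂ : 0 < A₂) (hC₂ : 0 ≤ C₂)
    (hSW : SWBound A₂ C₂) {x : ℝ} (hx : 9 ≤ x) {q : ℕ} (hq : 1 ≤ q)
    (hqx : (q : ℝ) ≤ (Real.log x / 2) ^ A₂) (a : (ZMod q)ˣ) {y : ℝ} (hy : 0 ≤ y) (hyx : y ≤ x) :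
    |ParityWave0.chebyshevPsiMod q a y - y / Nat.totient q| ≤
      7 * Real.sqrt x + C₂ * 2 ^ A₂ * x / Real.log x ^ A₂ := by
  have hL : 0 < Real.log x := Real.log_pos (by linarith)
  have hsx : 3 ≤ Real.sqrt x := by
    rw [show (3 : ℝ) = Real.sqrt 9 by
      rw [show (9 : ℝ) = 3 ^ 2 by norm_num, Real.sqrt_sq (by norm_num)]]
    exact Real.sqrt_le_sqrt hx
  have hT1 : 0 ≤ 7 * Real.sqrt x := by positivity
  have hT2 : 0 ≤ C₂ * 2 ^ A₂ * x / Real.log x ^ A₂ := by positivity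
  rcases le_or_gt y (Real.sqrt x) with hys | hys
  · -- trivial range
    refine le_trans ?_ (le_add_of_nonneg_right hT2)
    have hφ : (1 : ℝ) ≤ Nat.totient q := by exact_mod_cast Nat.totient_pos.2 hq
    have h1 : 0 ≤ ParityWave0.chebyshevPsiMod q a y :=
      Finset.sum_nonneg fun n _ => ArithmeticFunction.vonMangoldt.residueClass_nonneg _ n
    have h2 : ParityWave0.chebyshevPsiMod q a y ≤ Chebyshev.psi y := by
      rw [ParityWave0.chebyshevPsiMod, Chebyshev.psi, sum_range_succ_eq_sum_Ioc' _ (by simp)]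
      exact Finset.sum_le_sum fun n _ => ArithmeticFunction.vonMangoldt.residueClass_le _ n
    have h3 : Chebyshev.psi y ≤ (Real.log 4 + 4) * y := Chebyshev.psi_le_const_mul_self hy
    have h4 : Real.log 4 < 2 := by
      have := Real.log_lt_sub_one_of_pos (by norm_num : (0:ℝ) < 4) (by norm_num)
      have h44 : Real.log 4 = 2 * Real.log 2 := by
        rw [show (4:ℝ) = 2^2 by norm_num, Real.log_pow]; norm_num
      have := Real.log_two_lt_d9; linarith
    have h5 : 0 ≤ y / Nat.totient q := by positivity
    have h6 : y / Nat.totient q ≤ y := div_le_self hy hφ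
    rw [abs_le]; constructor <;> nlinarith
  · -- Siegel–Walfisz range
    refine le_trans ?_ (le_add_of_nonneg_left hT1)
    have hy2 : 2 ≤ y := by linarith
    have hly : Real.log x / 2 ≤ Real.log y := by
      rw [← Real.log_sqrt (by linarith)]
      exact Real.log_le_log (by linarith) hys.le
    have hly0 : 0 < Real.log x / 2 := by positivity
    have hqy : (q : ℝ) ≤ Real.log y ^ A₂ := hqx.trans (Real.rpow_le_rpow hly0.le hly hA₂.le)
    refine (hSW y hy2 q hq hqy a).trans ?_
    rw [div_le_div_iff₀ (Real.rpow_pos_of_pos (hly0.trans_le hly) _) (Real.rpow_pos_of_pos hL _)]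
    calc C₂ * y * Real.log x ^ A₂ = C₂ * y * ((Real.log x / 2) ^ A₂ * 2 ^ A₂) := by
          rw [← Real.mul_rpow hly0.le (by norm_num), div_mul_cancel₀ _ (two_ne_zero)]
      _ ≤ C₂ * x * (Real.log y ^ A₂ * 2 ^ A₂) := by
          gcongr
      _ = C₂ * 2 ^ A₂ * x * Real.log y ^ A₂ := by ring


/-! ### Step E: assembling the reduction -/

section StepE
open scoped Classical

/-- Steps A–C summed over `q ≤ Q`, with the order of summation swapped:
`∑_{q ≤ Q} max_a |ψ(y_q; q, a) − y_q/φ(q)| ≤ W(Q) ∑_{d ≤ Q} Φ(x; d) + ⌊log x/log 2⌋ Q log Q W(Q)`.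
[folklore] -/
theorem sum_iSup_le (Q : ℕ) {x : ℝ} (hx : 0 ≤ x) (y : ℕ → ℝ) (hy : ∀ q, 0 ≤ y q ∧ y q ≤ x) :
    ∑ q ∈ Icc 1 Q, ⨆ a : (ZMod q)ˣ, |ParityWave0.chebyshevPsiMod q a (y q) - y q / Nat.totient q| ≤
      totientInvSum Q * ∑ d ∈ Icc 1 Q, primTerm x d +
        ⌊Real.log x / Real.log 2⌋₊ * ((Q : ℝ) * Real.log Q * totientInvSum Q) := by
  set F : ℕ → ℝ := fun d => ∑ χ ∈ (univ : Finset (DirichletCharacter ℂ d)).filter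
    DirichletCharacter.IsPrimitive, majorant x ⟨d, χ⟩ with hF
  have hF0 : ∀ d, 0 ≤ F d := fun d => Finset.sum_nonneg fun _ _ => majorant_nonneg x _
  have h1 : ∀ q ∈ Icc 1 Q, ⨆ a : (ZMod q)ˣ, |ParityWave0.chebyshevPsiMod q a (y q) - y q / Nat.totient q| ≤
      ((Nat.totient q : ℝ))⁻¹ * ∑ d ∈ q.divisors, F d +
        ⌊Real.log x / Real.log 2⌋₊ * ((Q : ℝ) * Real.log Q) * ((Nat.totient q : ℝ))⁻¹ := by
    intro q hq
    have hq1 : 1 ≤ q := (Finset.mem_Icc.1 hq).1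
    have hqQ : q ≤ Q := (Finset.mem_Icc.1 hq).2
    haveI : NeZero q := ⟨by omega⟩
    have hφ : 0 < (Nat.totient q : ℝ) := by exact_mod_cast Nat.totient_pos.2 hq1
    refine (iSup_le_sum_primIndex q (hy q).1 (hy q).2).trans (add_le_add (le_of_eq ?_) ?_)
    · rw [primIndex, Finset.sum_sigma]
    · calc (q : ℝ) / Nat.totient q * nonCoprimePart q x
          ≤ (q : ℝ) / Nat.totient q * (⌊Real.log x / Real.log 2⌋₊ * Real.log q) :=
            mul_le_mul_of_nonneg_left (nonCoprimePart_le (by omega) hx) (by positivity)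
        _ ≤ (Q : ℝ) / Nat.totient q * (⌊Real.log x / Real.log 2⌋₊ * Real.log Q) := by
            gcongr
        _ = _ := by ring
  refine (Finset.sum_le_sum h1).trans ?_
  rw [Finset.sum_add_distrib, ← Finset.mul_sum, sum_mul_sum_divisors_eq Q]
  refine add_le_add ?_ (le_of_eq ?_)
  · calc ∑ d ∈ Icc 1 Q, F d * ∑ q ∈ Icc 1 Q with d ∣ q, ((Nat.totient q : ℝ))⁻¹
        ≤ ∑ d ∈ Icc 1 Q, F d * (((Nat.totient d : ℝ))⁻¹ * totientInvSum Q) :=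
          Finset.sum_le_sum fun d hd => mul_le_mul_of_nonneg_left
            (sum_filter_dvd_totient_inv_le Q (Finset.mem_Icc.1 hd).1) (hF0 d)
      _ = totientInvSum Q * ∑ d ∈ Icc 1 Q, primTerm x d := by
          rw [Finset.mul_sum]
          refine Finset.sum_congr rfl fun d _ => ?_
          rw [primTerm]; ring
  · rw [totientInvSum]; ring

/-- `Φ(x; 1) ≤ P(x)`. [folklore] -/
theorem primTerm_one_le (x : ℝ) : primTerm x 1 ≤ psiSubSelfSup x := by
  rw [primTerm, Nat.totient_one, Nat.cast_one, inv_one, one_mul]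
  have h : ∀ χ ∈ (univ : Finset (DirichletCharacter ℂ 1)).filter DirichletCharacter.IsPrimitive,
      majorant x ⟨1, χ⟩ = psiSubSelfSup x := fun χ _ => by simp [majorant]
  rw [Finset.sum_congr rfl h, Finset.sum_const, nsmul_eq_mul]
  have hcard : ((univ : Finset (DirichletCharacter ℂ 1)).filter
      DirichletCharacter.IsPrimitive).card ≤ 1 := by
    refine (Finset.card_filter_le _ _).trans ?_
    rw [Finset.card_univ, ← Nat.card_eq_fintype_card,
      DirichletCharacter.card_eq_totient_of_hasEnoughRootsOfUnity ℂ 1, Nat.totient_one]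
  calc _ ≤ (1 : ℝ) * psiSubSelfSup x := by
        gcongr
        · exact psiSubSelfSup_nonneg x
        · exact_mod_cast hcard
    _ = _ := one_mul _

/-- `P(x) ≤ 1 + 7√x + C₂ 2^{A₂} x/(log x)^{A₂}` from Siegel–Walfisz with `q = 1`. [folklore] -/
theorem psiSubSelfSup_le_of_SW {A₂ C₂ : ℝ} (hA₂ : 0 < A₂) (hC₂ : 0 ≤ C₂) (hSW : SWBound A₂ C₂)
    {x : ℝ} (hx : 9 ≤ x) (h1 : (1 : ℝ) ≤ (Real.log x / 2) ^ A₂) :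
    psiSubSelfSup x ≤ 1 + (7 * Real.sqrt x + C₂ * 2 ^ A₂ * x / Real.log x ^ A₂) := by
  rw [psiSubSelfSup]
  gcongr
  refine Finset.sup'_le _ _ fun N hN => ?_
  have hNx : (N : ℝ) ≤ x :=
    (Nat.cast_le.2 (Nat.lt_succ_iff.1 (mem_range.1 hN))).trans (Nat.floor_le (by linarith))
  have := abs_chebyshevPsiMod_sub_le_of_SW hA₂ hC₂ hSW hx le_rfl (by exact_mod_cast h1)
    (1 : (ZMod 1)ˣ) (Nat.cast_nonneg N) hNx
  simpa [ParityWave0.chebyshevPsiMod_one, Nat.totient_one] using this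

/-- For `2 ≤ d ≤ (log x / 2)^{A₂}`: `Φ(x; d) ≤ d (7√x + C₂ 2^{A₂} x/(log x)^{A₂})`. [folklore] -/
theorem primTerm_le_of_SW {A₂ C₂ : ℝ} (hA₂ : 0 < A₂) (hC₂ : 0 ≤ C₂) (hSW : SWBound A₂ C₂)
    {x : ℝ} (hx : 9 ≤ x) {d : ℕ} (hd : 2 ≤ d) (hdx : (d : ℝ) ≤ (Real.log x / 2) ^ A₂) :
    primTerm x d ≤ d * (7 * Real.sqrt x + C₂ * 2 ^ A₂ * x / Real.log x ^ A₂) := by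
  haveI : NeZero d := ⟨by omega⟩
  set E := 7 * Real.sqrt x + C₂ * 2 ^ A₂ * x / Real.log x ^ A₂ with hE
  have hL : 0 < Real.log x := Real.log_pos (by linarith)
  have hE0 : 0 ≤ E := by positivity
  have hφ : 0 < (Nat.totient d : ℝ) := by exact_mod_cast Nat.totient_pos.2 (by omega)
  have h1 : ∀ χ ∈ (univ : Finset (DirichletCharacter ℂ d)).filter DirichletCharacter.IsPrimitive,
      majorant x ⟨d, χ⟩ ≤ Nat.totient d * E := by
    intro χ hχ
    have hprim : χ.IsPrimitive := (Finset.mem_filter.1 hχ).2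
    have hne : χ ≠ 1 := by
      intro h
      rw [h, DirichletCharacter.isPrimitive_def, DirichletCharacter.conductor_one] at hprim
      omega
    rw [majorant, if_neg (show ¬ d = 1 by omega)]
    refine chebyshevPsiCharSup_le χ (fun N hN => ?_) (by linarith)
    refine (norm_chebyshevPsiChar_le_sum_units hne N).trans ?_
    calc ∑ a : (ZMod d)ˣ, |ParityWave0.chebyshevPsiMod d a N - N / Nat.totient d|
        ≤ ∑ _a : (ZMod d)ˣ, E := Finset.sum_le_sum fun a _ =>
          abs_chebyshevPsiMod_sub_le_of_SW hA₂ hC₂ hSW hx (by omega) hdx a (Nat.cast_nonneg N) hN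
      _ = Nat.totient d * E := by
          rw [Finset.sum_const, nsmul_eq_mul, Finset.card_univ, ZMod.card_units_eq_totient]
  have hcard : (((univ : Finset (DirichletCharacter ℂ d)).filter
      DirichletCharacter.IsPrimitive).card : ℝ) ≤ Nat.totient d := by
    have := (Finset.card_filter_le (univ : Finset (DirichletCharacter ℂ d))
      DirichletCharacter.IsPrimitive)
    rw [Finset.card_univ, ← Nat.card_eq_fintype_card,
      DirichletCharacter.card_eq_totient_of_hasEnoughRootsOfUnity ℂ d] at this
    exact_mod_cast this
  calc primTerm x d ≤ ((Nat.totient d : ℝ))⁻¹ * ∑ _χ ∈ (univ : Finset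
        (DirichletCharacter ℂ d)).filter DirichletCharacter.IsPrimitive, (Nat.totient d * E) := by
        rw [primTerm]
        exact mul_le_mul_of_nonneg_left (Finset.sum_le_sum h1) (inv_nonneg.2 hφ.le)
    _ = ((univ : Finset (DirichletCharacter ℂ d)).filter
          DirichletCharacter.IsPrimitive).card * E := by
        rw [Finset.sum_const, nsmul_eq_mul]; field_simp
    _ ≤ Nat.totient d * E := by gcongr
    _ ≤ d * E := by gcongr; exact_mod_cast Nat.totient_le d

/-- Abel summation, inequality form: for `a ≥ 0` with partial sums `T(k) = ∑_{d ≤ k} a_d`,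
`∑_{D < d ≤ Q} a_d / d ≤ T(Q)/(Q+1) + ∑_{D < k ≤ Q} T(k)/(k(k+1))`. [folklore] -/
theorem sum_Ioc_div_le_abel (a : ℕ → ℝ) (ha : ∀ d, 0 ≤ a d) (D Q : ℕ) :
    ∑ d ∈ Ioc D Q, a d / d ≤
      (∑ d ∈ Icc 1 Q, a d) / (Q + 1) + ∑ k ∈ Ioc D Q, (∑ d ∈ Icc 1 k, a d) / (k * (k + 1)) := by
  have hT : ∀ k, 0 ≤ ∑ d ∈ Icc 1 k, a d := fun k => Finset.sum_nonneg fun d _ => ha d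
  rcases le_or_gt D Q with hDQ | hQD
  · induction Q, hDQ using Nat.le_induction with
    | base =>
      rw [Finset.Ioc_self, Finset.sum_empty, Finset.sum_empty, add_zero]
      exact div_nonneg (hT D) (by positivity)
    | succ Q hDQ ih =>
      rw [Finset.sum_Ioc_succ_top hDQ, Finset.sum_Ioc_succ_top hDQ,
        Finset.sum_Icc_succ_top (by omega)]
      set T := ∑ d ∈ Icc 1 Q, a d
      have hQ0 : (0 : ℝ) < Q + 1 := by positivity
      have key : (T + a (Q + 1)) / ((Q + 1 : ℕ) + 1 : ℝ) +
          (T + a (Q + 1)) / (((Q + 1 : ℕ) : ℝ) * ((Q + 1 : ℕ) + 1)) =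
            T / (Q + 1) + a (Q + 1) / ((Q + 1 : ℕ) : ℝ) := by
        push_cast; field_simp
      linarith
  · rw [Finset.Ioc_eq_empty (by omega), Finset.sum_empty, Finset.sum_empty, add_zero]
    exact div_nonneg (hT Q) (by positivity)

/-- `∑_{D < k ≤ Q} 1/(k(k+1)) ≤ 1/(D+1)` (telescoping). [folklore] -/
theorem sum_Ioc_inv_mul_succ_le (D Q : ℕ) :
    ∑ k ∈ Ioc D Q, ((k : ℝ) * (k + 1))⁻¹ ≤ ((D : ℝ) + 1)⁻¹ := by
  rcases le_or_gt D Q with hDQ | hQD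
  · have : ∑ k ∈ Ioc D Q, ((k : ℝ) * (k + 1))⁻¹ = ((D : ℝ) + 1)⁻¹ - ((Q : ℝ) + 1)⁻¹ := by
      induction Q, hDQ using Nat.le_induction with
      | base => simp
      | succ Q hDQ ih =>
        rw [Finset.sum_Ioc_succ_top hDQ, ih]
        have h1 : (0 : ℝ) < Q + 1 := by positivity
        have h2 : (0 : ℝ) < D + 1 := by positivity
        push_cast; field_simp; ring
    rw [this]
    exact sub_le_self _ (by positivity)
  · rw [Finset.Ioc_eq_empty (by omega), Finset.sum_empty]; positivity

/-- The large conductors `D < d ≤ Q`: Abel summation and Vaughan's mean value theorem give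
`∑_{D < d ≤ Q} Φ(x; d) ≤ C₁ log⁴(xQ) [x/(Q+1) + x^{5/6} + x^{1/2} Q + x/(D+1)
  + x^{5/6} (1 + log Q) + x^{1/2} Q]`. [folklore] -/
theorem sum_Ioc_primTerm_le {C₁ : ℝ} (hC₁ : 0 ≤ C₁) (hV : VaughanBound C₁) {x : ℝ} (hx : 2 ≤ x)
    {Q D : ℕ} (hQ : 1 ≤ Q) (hD : 1 ≤ D) :
    ∑ d ∈ Ioc D Q, primTerm x d ≤ C₁ * Real.log (x * Q) ^ 4 *
      (x / (Q + 1) + x ^ (5 / 6 : ℝ) + x ^ (1 / 2 : ℝ) * Q +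
        (x / (D + 1) + x ^ (5 / 6 : ℝ) * (1 + Real.log Q) + x ^ (1 / 2 : ℝ) * Q)) := by
  have hx0 : 0 < x := by linarith
  set LQ := Real.log (x * Q) with hLQ
  set T : ℕ → ℝ := fun k => ∑ d ∈ Icc 1 k, vaughanTerm x d with hT
  have hK : 0 ≤ C₁ * LQ ^ 4 := by positivity
  have h56 : 0 ≤ x ^ (5 / 6 : ℝ) := by positivity
  have h12 : 0 ≤ x ^ (1 / 2 : ℝ) := by positivity
  -- Vaughan, in the form `T(k) ≤ C₁ LQ⁴ (x + x^{5/6} (k+1) + x^{1/2} k (k+1))` for `1 ≤ k ≤ Q`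
  have hTk : ∀ k : ℕ, 1 ≤ k → k ≤ Q →
      T k ≤ C₁ * LQ ^ 4 * (x + x ^ (5 / 6 : ℝ) * (k + 1) + x ^ (1 / 2 : ℝ) * (k * (k + 1))) := by
    intro k hk hkQ
    have hk1 : (1 : ℝ) ≤ k := by exact_mod_cast hk
    have hlogk : Real.log (x * k) ≤ LQ := by
      refine Real.log_le_log (by positivity) ?_
      gcongr
    have hlogk0 : 0 ≤ Real.log (x * k) := Real.log_nonneg (by nlinarith)
    have h1 : x + x ^ (5 / 6 : ℝ) * k + x ^ (1 / 2 : ℝ) * (k : ℝ) ^ 2 ≤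
        x + x ^ (5 / 6 : ℝ) * (k + 1) + x ^ (1 / 2 : ℝ) * (k * (k + 1)) := by
      have hk2 : (k : ℝ) ^ 2 ≤ k * (k + 1) := by nlinarith
      nlinarith [mul_le_mul_of_nonneg_left hk2 h12,
        mul_le_mul_of_nonneg_left (show (k : ℝ) ≤ k + 1 by linarith) h56]
    have h2 : Real.log (x * k) ^ 4 ≤ LQ ^ 4 := pow_le_pow_left₀ hlogk0 hlogk 4
    calc T k ≤ C₁ * (x + x ^ (5 / 6 : ℝ) * k + x ^ (1 / 2 : ℝ) * (k : ℝ) ^ 2) *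
          Real.log (x * k) ^ 4 := hV k hk x hx
      _ ≤ C₁ * (x + x ^ (5 / 6 : ℝ) * (k + 1) + x ^ (1 / 2 : ℝ) * (k * (k + 1))) * LQ ^ 4 :=
          mul_le_mul (mul_le_mul_of_nonneg_left h1 hC₁) h2 (by positivity) (by positivity)
      _ = _ := by ring
  rw [Finset.sum_congr rfl fun d hd => primTerm_eq_vaughanTerm_div x
    (show 2 ≤ d by have := (Finset.mem_Ioc.1 hd).1; omega)]
  refine (sum_Ioc_div_le_abel (vaughanTerm x) (vaughanTerm_nonneg x) D Q).trans ?_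
  rw [mul_add (C₁ * LQ ^ 4)]
  refine add_le_add ?_ ?_
  · -- `T(Q)/(Q+1)`
    have hQ0 : (0 : ℝ) < Q + 1 := by positivity
    rw [div_le_iff₀ hQ0]
    refine (hTk Q hQ le_rfl).trans (le_of_eq ?_)
    field_simp
  · -- `∑ T(k)/(k(k+1))`
    calc ∑ k ∈ Ioc D Q, T k / (k * (k + 1))
        ≤ ∑ k ∈ Ioc D Q, C₁ * LQ ^ 4 *
            (x * ((k : ℝ) * (k + 1))⁻¹ + x ^ (5 / 6 : ℝ) * ((k : ℝ))⁻¹ + x ^ (1 / 2 : ℝ)) := by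
          refine Finset.sum_le_sum fun k hk => ?_
          have hk1 : 1 ≤ k := by have := (Finset.mem_Ioc.1 hk).1; omega
          have hkQ : k ≤ Q := (Finset.mem_Ioc.1 hk).2
          have hk0 : (0 : ℝ) < k := by exact_mod_cast hk1
          rw [div_le_iff₀ (by positivity)]
          refine (hTk k hk1 hkQ).trans (le_of_eq ?_)
          field_simp
      _ = C₁ * LQ ^ 4 * (x * ∑ k ∈ Ioc D Q, ((k : ℝ) * (k + 1))⁻¹ +
            x ^ (5 / 6 : ℝ) * ∑ k ∈ Ioc D Q, ((k : ℝ))⁻¹ +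
            x ^ (1 / 2 : ℝ) * (Ioc D Q).card) := by
          rw [← Finset.mul_sum, Finset.sum_add_distrib, Finset.sum_add_distrib, ← Finset.mul_sum,
            ← Finset.mul_sum, Finset.sum_const, nsmul_eq_mul, mul_comm (((Ioc D Q).card : ℕ) : ℝ)]
      _ ≤ C₁ * LQ ^ 4 * (x * ((D : ℝ) + 1)⁻¹ + x ^ (5 / 6 : ℝ) * (1 + Real.log Q) +
            x ^ (1 / 2 : ℝ) * Q) := by
          gcongr
          · exact sum_Ioc_inv_mul_succ_le D Q
          · calc ∑ k ∈ Ioc D Q, ((k : ℝ))⁻¹ ≤ ∑ k ∈ Icc 1 Q, ((k : ℝ))⁻¹ :=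
                  Finset.sum_le_sum_of_subset_of_nonneg
                    (fun k hk => Finset.mem_Icc.2 ⟨by have := (Finset.mem_Ioc.1 hk).1; omega,
                      (Finset.mem_Ioc.1 hk).2⟩) fun _ _ _ => by positivity
              _ ≤ 1 + Real.log Q := harmonic_Icc_le Q
          · rw [Nat.card_Ioc]; exact_mod_cast Nat.sub_le Q D
      _ = _ := by ring

set_option maxHeartbeats 1600000 in
/-- The pointwise Bombieri–Vinogradov bound under the eventual side conditions on `x`, with
`B = A + 6`, Siegel–Walfisz exponent `A₂ = 3A + 14` and small/large cut `D = ⌊(log x)^B⌋`.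
[folklore] -/
theorem sum_iSup_le_of_bounds {A C₁ C₂ : ℝ} (hA : 1 ≤ A) (hC₁ : 0 ≤ C₁) (hV : VaughanBound C₁)
    (hC₂ : 0 ≤ C₂) (hSW : SWBound (3 * A + 14) C₂) {x : ℝ} (hx : 9 ≤ x) (hL : 2 ≤ Real.log x)
    (hLA : (2 : ℝ) ^ (3 * A + 14) ≤ Real.log x)
    (hM : Real.log x ^ (3 * A + 14) ≤ x ^ (1 / 6 : ℝ))
    (hQ : 1 ≤ ⌊x ^ (1 / 2 : ℝ) / Real.log x ^ (A + 6)⌋₊)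
    (y : ℕ → ℝ) (hy : ∀ q, y q ∈ Set.Icc 1 x) :
    ∑ q ∈ Icc 1 ⌊x ^ (1 / 2 : ℝ) / Real.log x ^ (A + 6)⌋₊,
        ⨆ a : (ZMod q)ˣ, |ParityWave0.chebyshevPsiMod q a (y q) - y q / Nat.totient q| ≤
      (36 * C₁ + 2 * (C₂ * 2 ^ (3 * A + 14)) + 16) * x / Real.log x ^ A := by
  have hx0 : 0 < x := by linarith
  have hx1 : 1 ≤ x := by linarith
  have hx2 : (2 : ℝ) ≤ x := by linarith
  have hA₂0 : 0 < 3 * A + 14 := by linarith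
  -- notation
  set L := Real.log x with hLdef
  set A₂ := 3 * A + 14 with hA₂def
  set B := A + 6 with hBdef
  set s := x ^ (1 / 2 : ℝ) with hsdef
  set u := x ^ (1 / 6 : ℝ) with hudef
  set Q := ⌊s / L ^ B⌋₊ with hQdef
  set D := ⌊L ^ B⌋₊ with hDdef
  set E := 7 * Real.sqrt x + C₂ * 2 ^ A₂ * x / L ^ A₂ with hEdef
  set M := x / L ^ A with hMdef
  set M₂ := x / L ^ (A + 2) with hM₂def
  -- positivity and power bookkeeping
  have hL0 : 0 < L := by linarith
  have hL1 : 1 ≤ L := by linarith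
  have hLp : ∀ e : ℝ, 0 < L ^ e := fun e => Real.rpow_pos_of_pos hL0 e
  have hLmono : ∀ {e₁ e₂ : ℝ}, e₁ ≤ e₂ → L ^ e₁ ≤ L ^ e₂ := fun h =>
    Real.rpow_le_rpow_of_exponent_le hL1 h
  have hLadd : ∀ e₁ e₂ : ℝ, L ^ (e₁ + e₂) = L ^ e₁ * L ^ e₂ := fun e₁ e₂ => Real.rpow_add hL0 e₁ e₂
  have hs0 : 0 < s := Real.rpow_pos_of_pos hx0 _
  have hu0 : 0 < u := Real.rpow_pos_of_pos hx0 _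
  have hss : s * s = x := by rw [hsdef, ← Real.rpow_add hx0]; norm_num
  have hsqrt : Real.sqrt x = s := Real.sqrt_eq_rpow x
  have h56 : 0 ≤ x ^ (5 / 6 : ℝ) := by positivity
  have h56u : x ^ (5 / 6 : ℝ) * u = x := by rw [hudef, ← Real.rpow_add hx0]; norm_num
  have hus : u ≤ s := Real.rpow_le_rpow_of_exponent_le hx1 (by norm_num)
  have hsx : s ≤ x := by
    calc s ≤ x ^ (1 : ℝ) := Real.rpow_le_rpow_of_exponent_le hx1 (by norm_num)
      _ = x := Real.rpow_one x
  have hux : u ≤ x := hus.trans hsx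
  have hP : ∀ e : ℝ, e ≤ A₂ → L ^ e ≤ u := fun e he => (hLmono he).trans hM
  have hL4 : L ^ (4 : ℝ) = L ^ 4 := by
    rw [show (4 : ℝ) = (4 : ℕ) by norm_num, Real.rpow_natCast]
  have hL2 : L ^ (2 : ℝ) = L ^ 2 := by
    rw [show (2 : ℝ) = (2 : ℕ) by norm_num, Real.rpow_natCast]
  have hLB : L ^ B = L ^ (A + 2) * L ^ 4 := by
    rw [← hL4, ← hLadd]; congr 1; simp only [hBdef]; ring
  have hLA2 : L ^ (A + 2) = L ^ A * L ^ 2 := by rw [← hL2, ← hLadd]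
  have hLA₂ : L ^ A₂ = (L ^ B * L ^ B) * L ^ (A + 2) := by
    rw [← hLadd, ← hLadd]; congr 1; simp only [hA₂def, hBdef]; ring
  have hM₂0 : 0 < M₂ := div_pos hx0 (hLp _)
  have hM₂M : L ^ 2 * M₂ = M := by
    rw [hM₂def, hMdef, hLA2]; field_simp
  have hE0' : 0 ≤ E := by rw [hEdef]; positivity
  have hC22 : 0 ≤ C₂ * 2 ^ A₂ := by positivity
  -- facts about `Q`
  have hQle : (Q : ℝ) ≤ s / L ^ B := Nat.floor_le (by positivity)
  have hQlt : s / L ^ B < Q + 1 := Nat.lt_floor_add_one _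
  have hQ1 : (1 : ℝ) ≤ Q := by exact_mod_cast hQ
  have hLB1 : 1 ≤ L ^ B := Real.one_le_rpow hL1 (by simp only [hBdef]; linarith)
  have hQs : (Q : ℝ) ≤ s := hQle.trans (div_le_self hs0.le hLB1)
  have hlogQ : Real.log Q ≤ L / 2 := by
    refine (Real.log_le_log (by linarith) hQs).trans (le_of_eq ?_)
    rw [hsdef, Real.log_rpow hx0]; ring
  have hlogQ0 : 0 ≤ Real.log Q := Real.log_nonneg hQ1
  have h1logQ : 1 + Real.log Q ≤ L := by linarith
  have hW : totientInvSum Q ≤ L ^ 2 :=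
    (totientInvSum_le Q).trans (pow_le_pow_left₀ (by linarith) h1logQ 2)
  have hLQ : Real.log (x * Q) ≤ 3 / 2 * L := by
    rw [Real.log_mul hx0.ne' (by positivity)]; linarith
  have hLQ0 : 0 ≤ Real.log (x * Q) := Real.log_nonneg (by nlinarith)
  have hLQ4 : Real.log (x * Q) ^ 4 ≤ 6 * L ^ 4 := by
    calc Real.log (x * Q) ^ 4 ≤ (3 / 2 * L) ^ 4 := pow_le_pow_left₀ hLQ0 hLQ 4
      _ = 81 / 16 * L ^ 4 := by ring
      _ ≤ 6 * L ^ 4 := by gcongr; norm_num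
  -- facts about `D`
  have hDle : (D : ℝ) ≤ L ^ B := Nat.floor_le (by positivity)
  have hDlt : L ^ B < D + 1 := Nat.lt_floor_add_one _
  have hD1 : 1 ≤ D := Nat.le_floor (by exact_mod_cast hLB1)
  -- Siegel–Walfisz applicability: `L^B ≤ (L/2)^{A₂}` and `1 ≤ (L/2)^{A₂}`
  have hSWapp : L ^ B ≤ (L / 2) ^ A₂ := by
    rw [Real.div_rpow hL0.le (by norm_num), le_div_iff₀ (by positivity)]
    calc L ^ B * 2 ^ A₂ ≤ L ^ B * L := by gcongr
      _ = L ^ (B + 1) := by rw [hLadd B 1, Real.rpow_one]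
      _ ≤ L ^ A₂ := hLmono (by simp only [hA₂def, hBdef]; linarith)
  have h1SW : (1 : ℝ) ≤ (L / 2) ^ A₂ := hLB1.trans hSWapp
  -- Steps A–C summed (E0) and the three ranges of `d`
  have hy' : ∀ q, 0 ≤ y q ∧ y q ≤ x := fun q => ⟨zero_le_one.trans (hy q).1, (hy q).2⟩
  have hE0 := sum_iSup_le Q hx0.le y hy'
  have hE1 : primTerm x 1 ≤ 1 + E :=
    (primTerm_one_le x).trans (psiSubSelfSup_le_of_SW hA₂0 hC₂ hSW hx h1SW)
  have hE2 : ∀ d ∈ (Ioc 1 Q).filter (fun d => d ≤ D), primTerm x d ≤ D * E := by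
    intro d hd
    rw [Finset.mem_filter, Finset.mem_Ioc] at hd
    have hdD : (d : ℝ) ≤ D := by exact_mod_cast hd.2
    calc primTerm x d ≤ d * E :=
          primTerm_le_of_SW hA₂0 hC₂ hSW hx hd.1.1 ((hdD.trans hDle).trans hSWapp)
      _ ≤ D * E := by gcongr
  have hE4 := sum_Ioc_primTerm_le hC₁ hV hx2 hQ hD1
  have hsplit : ∑ d ∈ Icc 1 Q, primTerm x d ≤
      primTerm x 1 + (D * (D * E)) + ∑ d ∈ Ioc D Q, primTerm x d := by
    rw [Finset.Icc_eq_cons_Ioc hQ, Finset.sum_cons, add_assoc,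
      ← Finset.sum_filter_add_sum_filter_not (Ioc 1 Q) (fun d => d ≤ D)]
    gcongr primTerm x 1 + (?_ + ?_)
    · calc ∑ d ∈ (Ioc 1 Q).filter (fun d => d ≤ D), primTerm x d
          ≤ ∑ _d ∈ (Ioc 1 Q).filter (fun d => d ≤ D), (D : ℝ) * E := Finset.sum_le_sum hE2
        _ = ((Ioc 1 Q).filter (fun d => d ≤ D)).card * (D * E) := by
          rw [Finset.sum_const, nsmul_eq_mul]
        _ ≤ D * (D * E) := by
          gcongr
          have : (Ioc 1 Q).filter (fun d => d ≤ D) ⊆ Ioc 0 D := fun d hd => by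
            rw [Finset.mem_filter, Finset.mem_Ioc] at hd
            exact Finset.mem_Ioc.2 ⟨by omega, hd.2⟩
          have := Finset.card_le_card this
          rw [Nat.card_Ioc] at this
          exact_mod_cast this
    · refine Finset.sum_le_sum_of_subset_of_nonneg (fun d hd => ?_) fun d _ _ => primTerm_nonneg x d
      rw [Finset.mem_filter, Finset.mem_Ioc] at hd
      exact Finset.mem_Ioc.2 ⟨by omega, hd.1.2⟩
  -- (i)–(iii): `1`, `√x` and `x/L^{A₂}` are at most `M₂ = x/L^{A+2}`
  have hi : 1 ≤ M₂ := by
    rw [hM₂def, le_div_iff₀ (hLp _), one_mul]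
    exact (hP (A + 2) (by simp only [hA₂def]; linarith)).trans hux
  have hii : Real.sqrt x ≤ M₂ := by
    rw [hsqrt, hM₂def, le_div_iff₀ (hLp _)]
    calc s * L ^ (A + 2) ≤ s * s := by
          gcongr; exact (hP (A + 2) (by simp only [hA₂def]; linarith)).trans hus
      _ = x := hss
  have hiii : x / L ^ A₂ ≤ M₂ :=
    div_le_div_of_nonneg_left hx0.le (hLp _) (hLmono (by simp only [hA₂def]; linarith))
  have hEM : E ≤ (7 + C₂ * 2 ^ A₂) * M₂ := by
    have h := mul_le_mul_of_nonneg_left hiii hC22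
    calc E = 7 * Real.sqrt x + C₂ * 2 ^ A₂ * (x / L ^ A₂) := by rw [hEdef]; ring
      _ ≤ 7 * M₂ + C₂ * 2 ^ A₂ * M₂ := by gcongr
      _ = _ := by ring
  -- (iv) the small conductors: `D² E ≤ (7 + C₂ 2^{A₂}) M₂`
  have hiv : (D : ℝ) * (D * E) ≤ (7 + C₂ * 2 ^ A₂) * M₂ := by
    have h1 : L ^ B * L ^ B * Real.sqrt x ≤ M₂ := by
      rw [hsqrt, hM₂def, le_div_iff₀ (hLp _)]
      calc L ^ B * L ^ B * s * L ^ (A + 2) = L ^ A₂ * s := by rw [hLA₂]; ring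
        _ ≤ s * s := by gcongr; exact (hP A₂ le_rfl).trans hus
        _ = x := hss
    have h2 : L ^ B * L ^ B * (x / L ^ A₂) = M₂ := by
      rw [hLA₂, hM₂def]; field_simp
    calc (D : ℝ) * (D * E) = (D * D) * E := by ring
      _ ≤ (L ^ B * L ^ B) * E := by gcongr
      _ = 7 * (L ^ B * L ^ B * Real.sqrt x) + C₂ * 2 ^ A₂ * (L ^ B * L ^ B * (x / L ^ A₂)) := by
          rw [hEdef]; ring
      _ ≤ 7 * M₂ + C₂ * 2 ^ A₂ * M₂ := by rw [h2]; gcongr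
      _ = _ := by ring
  -- (v) the large conductors: `≤ 36 C₁ M₂`
  have hv : ∑ d ∈ Ioc D Q, primTerm x d ≤ 36 * C₁ * M₂ := by
    have hxB : ∀ t : ℝ, t * L ^ B ≤ x → t ≤ x / L ^ B := fun t ht => (le_div_iff₀ (hLp B)).2 ht
    have t1 : x / (Q + 1) ≤ x / L ^ B := by
      refine div_le_div_of_nonneg_left hx0.le (hLp B) (le_trans ?_ hQlt.le)
      rw [le_div_iff₀ (hLp B)]
      calc L ^ B * L ^ B = L ^ (B + B) := (hLadd B B).symm
        _ ≤ u := hP _ (by simp only [hA₂def, hBdef]; linarith)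
        _ ≤ s := hus
    have t2 : x ^ (5 / 6 : ℝ) ≤ x / L ^ B := hxB _ (by
      calc x ^ (5 / 6 : ℝ) * L ^ B ≤ x ^ (5 / 6 : ℝ) * u := by
            gcongr; exact hP B (by simp only [hA₂def, hBdef]; linarith)
        _ = x := h56u)
    have t3 : s * Q ≤ x / L ^ B := hxB _ (by
      calc s * Q * L ^ B = s * (Q * L ^ B) := by ring
        _ ≤ s * s := by gcongr; exact (le_div_iff₀ (hLp B)).1 hQle
        _ = x := hss)
    have t4 : x / (D + 1) ≤ x / L ^ B := div_le_div_of_nonneg_left hx0.le (hLp B) hDlt.le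
    have t5 : x ^ (5 / 6 : ℝ) * (1 + Real.log Q) ≤ x / L ^ B := hxB _ (by
      calc x ^ (5 / 6 : ℝ) * (1 + Real.log Q) * L ^ B ≤ x ^ (5 / 6 : ℝ) * L * L ^ B := by gcongr
        _ = x ^ (5 / 6 : ℝ) * L ^ (B + 1) := by rw [hLadd B 1, Real.rpow_one]; ring
        _ ≤ x ^ (5 / 6 : ℝ) * u := by
            gcongr; exact hP _ (by simp only [hA₂def, hBdef]; linarith)
        _ = x := h56u)
    have hbr : x / (Q + 1) + x ^ (5 / 6 : ℝ) + s * Q +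
        (x / (D + 1) + x ^ (5 / 6 : ℝ) * (1 + Real.log Q) + s * Q) ≤ 6 * (x / L ^ B) := by
      linarith only [t1, t2, t3, t4, t5]
    have hbr0 : 0 ≤ x / (Q + 1) + x ^ (5 / 6 : ℝ) + s * Q +
        (x / (D + 1) + x ^ (5 / 6 : ℝ) * (1 + Real.log Q) + s * Q) := by positivity
    have hxLB : L ^ 4 * (x / L ^ B) = M₂ := by
      have h4 : (L ^ 4 : ℝ) ≠ 0 := by positivity
      rw [hLB, hM₂def, div_mul_eq_div_div, mul_div_assoc', mul_div_cancel_left₀ _ h4]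
    calc ∑ d ∈ Ioc D Q, primTerm x d ≤ _ := hE4
      _ ≤ C₁ * (6 * L ^ 4) * (6 * (x / L ^ B)) :=
          mul_le_mul (mul_le_mul_of_nonneg_left hLQ4 hC₁) hbr hbr0 (by positivity)
      _ = 36 * C₁ * (L ^ 4 * (x / L ^ B)) := by ring
      _ = 36 * C₁ * M₂ := by rw [hxLB]
  -- assembling
  have hSum : ∑ d ∈ Icc 1 Q, primTerm x d ≤ (36 * C₁ + 2 * (C₂ * 2 ^ A₂) + 15) * M₂ := by
    linarith
  have hSum0 : 0 ≤ ∑ d ∈ Icc 1 Q, primTerm x d := Finset.sum_nonneg fun d _ => primTerm_nonneg x d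
  have hWSum : totientInvSum Q * ∑ d ∈ Icc 1 Q, primTerm x d ≤
      L ^ 2 * ((36 * C₁ + 2 * (C₂ * 2 ^ A₂) + 15) * M₂) :=
    mul_le_mul hW hSum hSum0 (by positivity)
  have hR : (⌊L / Real.log 2⌋₊ : ℝ) * ((Q : ℝ) * Real.log Q * totientInvSum Q) ≤ M := by
    have hlog2 : (1 : ℝ) / 2 ≤ Real.log 2 := by
      have := Real.log_two_gt_d9; linarith
    have hfl : (⌊L / Real.log 2⌋₊ : ℝ) ≤ 2 * L := by
      refine (Nat.floor_le (by positivity)).trans ?_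
      rw [div_le_iff₀ (by positivity)]; nlinarith
    have hQW : (Q : ℝ) * Real.log Q * totientInvSum Q ≤ s / L ^ B * (L / 2) * L ^ 2 :=
      mul_le_mul (mul_le_mul hQle hlogQ hlogQ0 (by positivity)) hW (totientInvSum_nonneg Q)
        (by positivity)
    have hQW0 : 0 ≤ (Q : ℝ) * Real.log Q * totientInvSum Q :=
      mul_nonneg (mul_nonneg (Nat.cast_nonneg _) hlogQ0) (totientInvSum_nonneg Q)
    calc (⌊L / Real.log 2⌋₊ : ℝ) * ((Q : ℝ) * Real.log Q * totientInvSum Q)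
        ≤ 2 * L * (s / L ^ B * (L / 2) * L ^ 2) := mul_le_mul hfl hQW hQW0 (by positivity)
      _ = s / L ^ (A + 2) := by rw [hLB]; field_simp
      _ ≤ M := div_le_div₀ hx0.le hsx (hLp A) (hLmono (by linarith))
  calc ∑ q ∈ Icc 1 Q, ⨆ a : (ZMod q)ˣ, |ParityWave0.chebyshevPsiMod q a (y q) - y q / Nat.totient q|
      ≤ _ := hE0
    _ ≤ L ^ 2 * ((36 * C₁ + 2 * (C₂ * 2 ^ A₂) + 15) * M₂) + M := add_le_add hWSum hR
    _ = (36 * C₁ + 2 * (C₂ * 2 ^ A₂) + 16) * M := by rw [← hM₂M]; ring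
    _ = _ := by rw [hMdef, mul_div_assoc]

end StepE


/-! ### Step F: the eventual side conditions; the reduction theorem -/

section StepF
open Filter

/-- Siegel–Walfisz in the packaged form `SWBound A₂ C₂` with `C₂ ≥ 0`. [folklore] -/
theorem swBound_of_siegel_walfisz (hSW : siegel_walfisz) {A₂ : ℝ} (hA₂ : 0 < A₂) :
    ∃ C₂, 0 ≤ C₂ ∧ SWBound A₂ C₂ := by
  obtain ⟨C, hC⟩ := hSW A₂ hA₂
  refine ⟨max C 0, le_max_right _ _, fun x hx q hq hqx a => (hC x hx q hq hqx a).trans ?_⟩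
  have hL : 0 < Real.log x ^ A₂ := Real.rpow_pos_of_pos (Real.log_pos (by linarith)) _
  rw [mul_div_assoc, mul_div_assoc]
  exact mul_le_mul_of_nonneg_right (le_max_left _ _) (by positivity)

/-- `(log x)^r ≤ x^s` eventually, for `s > 0`. [folklore] -/
theorem eventually_log_rpow_le_rpow (r : ℝ) {s : ℝ} (hs : 0 < s) :
    ∀ᶠ x : ℝ in atTop, Real.log x ^ r ≤ x ^ s := by
  filter_upwards [(isLittleO_log_rpow_rpow_atTop r hs).eventuallyLE, eventually_ge_atTop 1]
    with x hx hx1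
  rwa [Real.norm_of_nonneg (Real.rpow_nonneg (Real.log_nonneg hx1) _),
    Real.norm_of_nonneg (Real.rpow_nonneg (zero_le_one.trans hx1) _)] at hx

/-- **The reduction** (Vaughan's proof of the Bombieri–Vinogradov theorem: Vaughan, Acta Arith. 37
(1980), Theorem 3 "Theorem 1 combined with the Siegel–Walfisz theorem easily gives"; Davenport,
*Multiplicative Number Theory*, ch. 28; Cojocaru–Murty, *An Introduction to Sieve Methods and their
Applications*, §9.2, proof of Theorem 9.2.1, (9.30)–(9.34)). Vaughan's mean value theorem
(`vaughan_meanValue`, Vaughan 1980 Theorem 1) and the Siegel–Walfisz theorem (`siegel_walfisz`,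
parity.S28) imply the Bombieri–Vinogradov theorem `bombieri_vinogradov` (parity.S27) in the vendored
form, with `B = max(A, 1) + 6`. [cite: CojocaruMurty2005, §9.2, proof of Theorem 9.2.1] -/
theorem bombieri_vinogradov_of_vaughan_of_siegelWalfisz (hV : vaughan_meanValue)
    (hSW : siegel_walfisz) : bombieri_vinogradov := by
  intro A₀
  obtain ⟨C₁, hC₁, hVB⟩ := vaughanBound_of_vaughan_meanValue hV
  obtain ⟨C₂, hC₂, hSWB⟩ := swBound_of_siegel_walfisz hSW
    (show (0 : ℝ) < 3 * max A₀ 1 + 14 by positivity)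
  set A := max A₀ 1 with hAdef
  have hA : 1 ≤ A := le_max_right _ _
  refine ⟨A + 6, 36 * C₁ + 2 * (C₂ * 2 ^ (3 * A + 14)) + 16, ?_⟩
  filter_upwards [eventually_ge_atTop (9 : ℝ),
    Real.tendsto_log_atTop.eventually_ge_atTop ((2 : ℝ) ^ (3 * A + 14) + 2),
    eventually_log_rpow_le_rpow (3 * A + 14) (by norm_num : (0 : ℝ) < 1 / 6),
    eventually_log_rpow_le_rpow (A + 6) (by norm_num : (0 : ℝ) < 1 / 2)] with x hx hL2 hM hQ' y hy
  have h2A : (0 : ℝ) ≤ 2 ^ (3 * A + 14) := by positivity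
  have hL : 2 ≤ Real.log x := by linarith
  have hL0 : 0 < Real.log x := by linarith
  have hLA : (2 : ℝ) ^ (3 * A + 14) ≤ Real.log x := by linarith
  have hQ : 1 ≤ ⌊x ^ (1 / 2 : ℝ) / Real.log x ^ (A + 6)⌋₊ := by
    refine Nat.le_floor ?_
    rwa [Nat.cast_one, le_div_iff₀ (Real.rpow_pos_of_pos hL0 _), one_mul]
  refine (sum_iSup_le_of_bounds hA hC₁ hVB hC₂ hSWB hx hL hLA hM hQ y hy).trans ?_
  rw [mul_div_assoc, mul_div_assoc]
  refine mul_le_mul_of_nonneg_left ?_ (by positivity)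
  exact div_le_div_of_nonneg_left (by linarith) (Real.rpow_pos_of_pos hL0 _)
    (Real.rpow_le_rpow_of_exponent_le (by linarith) (le_max_left _ _))

end StepF

end Literature.NumberTheory.Sieve
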